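import Mathlib
import Summits.ResolutionOfSingularities.ResolutionOfSingularities.Theorems.WeightedInvariantLocalWeightedDropWildMonicMaxFlagLimit
import Summits.ResolutionOfSingularities.ResolutionOfSingularities.Theorems.WeightedInvariantLocalWeightedDropWildMonicMaxFlagCloseDefs
import Summits.ResolutionOfSingularities.ResolutionOfSingularities.Theorems.WeightedInvariantLocalWeightedDropWildMonicFlagPairComplete
import Summits.ResolutionOfSingularities.ResolutionOfSingularities.Theorems.WeightedInvariantLocalWeightedDropWildMonicFlagShearSetting
import Summits.ResolutionOfSingularities.ResolutionOfSingularities.Theorems.WeightedInvariantLocalWeightedDropWildMonicFlagShearOrder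
import Summits.ResolutionOfSingularities.ResolutionOfSingularities.Theorems.WeightedInvariantLocalWeightedDropWildMonicSCleanShift

/-!
# `WeightedInvariant.LocalWeightedDrop`, line `hasse-ridge-face-selection`, S3ρ sub-stub S3ρD `stub_wildMonicSurfaceDescent`: item D-0
# «maximising flag» — `s`-ATTAINMENT OVER PAIRS `(g, h)` (D-0d, case (β): `x₁` not a boundary letter), THE KERNEL INSTANTIATION

Crux item stmt-ResolutionOfSingularities-8899 `LocalWeightedDrop` (route `ResolutionOfSingularities/WeightedInvariant`), engine of the door
`HypersurfaceCentreConstruction` stmt-ResolutionOfSingularities-19897.  [OURS · L1 W4.3, chain w43, res-D-pv-056 AS res-L1-w43-stub-5 (D-0 split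
with res-L1-w43-stub-3 g4, STATUS 2026-08-27T09:13:24Z: this file = stub-5, the bridge to `hattain₀` = stub-3).  MODEL: S. Perlega,
arXiv:2011.14443 Ch. 5 §3 Prop. 5.3.5 (`maximum_over_y_and_z_exists`) with Lemma 5.3.3 (`s_under_double_coord_changes`), for the flags
`(g, h)` of a position whose curve letter `x₁` is NOT exceptional (so `h` varies).  This file INSTANTIATES stub-5's abstract limit kernel
`exists_isGreatest_of_complete₂` (…WildMonicMaxFlagLimit) on the class of pairs with a fixed setting, with
* `hcomplete` := res-L1-w43-stub-3's `exists_limit_mem_pairClass` (…WildMonicFlagPairComplete: the limit pair stays in the class),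
* `husc` := stub-3's `le_sFlag_shear_of_not_mem` (Lemma 5.3.3 (1), plane half, hypothesis-free) + stub-7's `natCast_le_sFlag_shift` (Lemma 5.2.2 (1)),
* `hdrop` := stub-7's `sFlag_shift_lt` (Lemma 5.2.2 (3)) for the re-centring half, GIVEN the plane half «`s` kept ⇒ `s ≤ δ₀!·ord(h_b − h_a)`» of
  Lemma 5.3.3 (3) — which needs ord-cleanness of `f` and is carried, exactly as Perlega states it, as the HYPOTHESIS `h3h` on ord-clean members
  (`P`), together with Lemma 5.3.4 as the HYPOTHESIS `hclean` (every member may be replaced by an ord-clean one with no smaller `s`),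
* `htrans` := the relative re-centrings compose (`relG`, …MaxFlagCloseDefs) and the plane shear does not lower a line weight on or above its line
  (stub-3's `le_weightedOrder_subst_shift`).
Nothing here is a statement of H. Hironaka's manuscript [claim: Hironaka2017, status: under-review]; every object is OURS.]

* **`exists_isGreatest_sFlag_pair_of`** — PER17 PROP. 5.3.5 FOR PAIRS modulo (3h) + (5.3.4): in the setting class of pairs a member with
  finite GREATEST `sFlag` exists, given non-emptiness and finiteness of `sFlag` on the class.
-/

set_option linter.dupNamespace false -- mandated namespace of this single-conjunct summit

noncomputable section

namespace Summit.ResolutionOfSingularities.ResolutionOfSingularities.Theorems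

namespace WildMonic

open MvPowerSeries

variable {k : Type} [Field k] {d : ℕ}

/-- The flag tuple of `b` is the relative re-centring of the SHEARED flag tuple of `a`:
`flagTuple d A b.1 b.2 = shift d (θ_{b.2−a.2}^* (flagTuple d A a.1 a.2)) (relG a b)`. -/
theorem flagTuple_eq_shift_shear_relG (A : Fin d → MvPowerSeries (Fin 2) k) (a b : MvPowerSeries (Fin 2) k × PowerSeries k)
    (ha : PowerSeries.constantCoeff a.2 = 0) (hb : PowerSeries.constantCoeff b.2 = 0) :
    flagTuple d A b.1 b.2 = shift d (fun i => subst (PurePowerFlag.shift (b.2 - a.2)) (flagTuple d A a.1 a.2 i)) (relG a b) := by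
  rw [← flagTuple_relG A a b ha hb, flagTuple_def]

/-- **PER17 PROP. 5.3.5 FOR PAIRS `(g, h)`, `x₁` NOT A BOUNDARY LETTER — modulo the plane half (3h) of Lemma 5.3.3 (3) and Lemma 5.3.4.**
Position `A`, boundary `E` with `1 ∉ E`, `0 < d`; a family of weights `W` with target values `m` cutting out the SETTING CLASS
`G = {(g, h) : g(0) = 0, h(0) = 0, ∀ w ∈ W, wMin w (flagTuple d A g h) = m w}` (the hypotheses `hW`, `hpos`, `hmax` are those of stub-3's
completeness `exists_limit_mem_pairClass`), on which `(dRes, excExp) = (δ₀, r₀)` (`hδ`, `hr`).  `P` = «`f` is ord-clean at the pair», with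
`hclean` (Lemma 5.3.4: above the threshold `B₀` every member is dominated in `sFlag` by an ord-clean member) and `h3h` (Lemma 5.3.3 (3), plane
half: from an ord-clean member with `sFlag = M > B₀`, a member with `sFlag ≥ M` has `M ≤ δ₀!·ord(h_b − h_a)`).  If `G` is non-empty and `sFlag`
is finite on it, some member has the GREATEST `sFlag`, finite.
[cite: Perlega2020, Prop. 5.3.5 `maximum_over_y_and_z_exists` with Lemmas 5.3.3, 5.3.4 (arXiv:2011.14443 Ch. 5 §3, p0066 L60 – p0067 L40)] -/
theorem exists_isGreatest_sFlag_pair_of (hd : 0 < d) {E : Finset (Fin 2)} (hE : (1 : Fin 2) ∉ E) (A : Fin d → MvPowerSeries (Fin 2) k)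
    (W : Set (Fin 2 → ℕ)) (m : (Fin 2 → ℕ) → ℕ∞) (δ₀ : ℕ) (r₀ : Fin 2 →₀ ℕ)
    (hW : ∀ w ∈ W, ∀ φ : PowerSeries k, PowerSeries.constantCoeff φ = 0 →
      (∀ B : Fin d → MvPowerSeries (Fin 2) k, wMin w (fun i => subst (PurePowerFlag.shift φ) (B i)) = wMin w B) ∧
      ∀ g : MvPowerSeries (Fin 2) k, (subst (PurePowerFlag.shift φ) g).weightedOrder w = g.weightedOrder w)
    (hpos : ∃ w ∈ W, 0 < m w)
    (hmax : ∀ (g : MvPowerSeries (Fin 2) k) (h : PowerSeries k), constantCoeff g = 0 → PowerSeries.constantCoeff h = 0 →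
      (∀ w ∈ W, m w ≤ wMin w (flagTuple d A g h)) → ∀ w ∈ W, wMin w (flagTuple d A g h) ≤ m w)
    (hδ : ∀ (g : MvPowerSeries (Fin 2) k) (h : PowerSeries k), constantCoeff g = 0 → PowerSeries.constantCoeff h = 0 →
      (∀ w ∈ W, wMin w (flagTuple d A g h) = m w) → dRes E (newtonSet (flagTuple d A g h)) = δ₀)
    (hr : ∀ (g : MvPowerSeries (Fin 2) k) (h : PowerSeries k), constantCoeff g = 0 → PowerSeries.constantCoeff h = 0 →
      (∀ w ∈ W, wMin w (flagTuple d A g h) = m w) → excExp E (newtonSet (flagTuple d A g h)) = r₀)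
    (P : MvPowerSeries (Fin 2) k × PowerSeries k → Prop) (B₀ : ℕ)
    (hclean : ∀ a : MvPowerSeries (Fin 2) k × PowerSeries k, constantCoeff a.1 = 0 → PowerSeries.constantCoeff a.2 = 0 →
      (∀ w ∈ W, wMin w (flagTuple d A a.1 a.2) = m w) → (B₀ : ℕ∞) < sFlag E (newtonSet (flagTuple d A a.1 a.2)) →
      sFlag E (newtonSet (flagTuple d A a.1 a.2)) ≠ ⊤ →
      ∃ b : MvPowerSeries (Fin 2) k × PowerSeries k, constantCoeff b.1 = 0 ∧ PowerSeries.constantCoeff b.2 = 0 ∧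
        (∀ w ∈ W, wMin w (flagTuple d A b.1 b.2) = m w) ∧ P b ∧
        sFlag E (newtonSet (flagTuple d A a.1 a.2)) ≤ sFlag E (newtonSet (flagTuple d A b.1 b.2)))
    (h3h : ∀ (a b : MvPowerSeries (Fin 2) k × PowerSeries k) (M : ℕ), constantCoeff a.1 = 0 → PowerSeries.constantCoeff a.2 = 0 →
      (∀ w ∈ W, wMin w (flagTuple d A a.1 a.2) = m w) → P a → constantCoeff b.1 = 0 → PowerSeries.constantCoeff b.2 = 0 →
      (∀ w ∈ W, wMin w (flagTuple d A b.1 b.2) = m w) → B₀ < M → sFlag E (newtonSet (flagTuple d A a.1 a.2)) = M →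
      (M : ℕ∞) ≤ sFlag E (newtonSet (flagTuple d A b.1 b.2)) → (M : ℕ∞) ≤ (δ₀.factorial : ℕ∞) * (b.2 - a.2).order)
    (hne : ∃ (g : MvPowerSeries (Fin 2) k) (h : PowerSeries k), constantCoeff g = 0 ∧ PowerSeries.constantCoeff h = 0 ∧
      ∀ w ∈ W, wMin w (flagTuple d A g h) = m w)
    (hfin : ∀ (g : MvPowerSeries (Fin 2) k) (h : PowerSeries k), constantCoeff g = 0 → PowerSeries.constantCoeff h = 0 →
      (∀ w ∈ W, wMin w (flagTuple d A g h) = m w) → sFlag E (newtonSet (flagTuple d A g h)) ≠ ⊤) :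
    ∃ (g : MvPowerSeries (Fin 2) k) (h : PowerSeries k), constantCoeff g = 0 ∧ PowerSeries.constantCoeff h = 0 ∧
      (∀ w ∈ W, wMin w (flagTuple d A g h) = m w) ∧ sFlag E (newtonSet (flagTuple d A g h)) ≠ ⊤ ∧
      ∀ (g' : MvPowerSeries (Fin 2) k) (h' : PowerSeries k), constantCoeff g' = 0 → PowerSeries.constantCoeff h' = 0 →
        (∀ w ∈ W, wMin w (flagTuple d A g' h') = m w) →
        sFlag E (newtonSet (flagTuple d A g' h')) ≤ sFlag E (newtonSet (flagTuple d A g h)) := by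
  classical
  -- the class, the value, the closeness
  let Φ := MvPowerSeries (Fin 2) k × PowerSeries k
  let G : Φ → Prop := fun a => constantCoeff a.1 = 0 ∧ PowerSeries.constantCoeff a.2 = 0 ∧ ∀ w ∈ W, wMin w (flagTuple d A a.1 a.2) = m w
  let s : Φ → ℕ∞ := fun a => sFlag E (newtonSet (flagTuple d A a.1 a.2))
  let Close : ℕ → Φ → Φ → Prop := fun M a b =>
    G b ∧ (M : ℕ∞) ≤ (δ₀.factorial : ℕ∞) * (b.2 - a.2).order ∧
      ∀ M', M' ≤ M → ((M' * δ₀ + Finsupp.weight ![δ₀.factorial, M'] r₀ : ℕ) : ℕ∞) ≤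
        (d.factorial : ℕ∞) * (relG a b).weightedOrder ![δ₀.factorial, M']
  -- the sheared flag tuple of `a` by `H = b.2 − a.2`: same setting, `sFlag ≥ M` kept when `M ≤ δ₀!·ord H` (Per17 L5.3.3 (1), plane half)
  have hshear : ∀ {a b : Φ} {M : ℕ}, G a → G b → s a = M → (M : ℕ∞) ≤ (δ₀.factorial : ℕ∞) * (b.2 - a.2).order →
      let C' := fun i => subst (PurePowerFlag.shift (b.2 - a.2)) (flagTuple d A a.1 a.2 i)
      flagTuple d A b.1 b.2 = shift d C' (relG a b) ∧ (M : ℕ∞) ≤ sFlag E (newtonSet C') ∧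
        dRes E (newtonSet C') = δ₀ ∧ excExp E (newtonSet C') = r₀ ∧
        dRes E (newtonSet (shift d C' (relG a b))) = dRes E (newtonSet C') ∧
        excExp E (newtonSet (shift d C' (relG a b))) = excExp E (newtonSet C') := by
    intro a b M ha hb hsa hH
    have hH0 : PowerSeries.constantCoeff (b.2 - a.2) = 0 := by rw [map_sub, ha.2.1, hb.2.1, sub_zero]
    have hflag := flagTuple_eq_shift_shear_relG A a b ha.2.1 hb.2.1
    have hδa := hδ a.1 a.2 ha.1 ha.2.1 ha.2.2
    have hra := hr a.1 a.2 ha.1 ha.2.1 ha.2.2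
    have hδC : dRes E (newtonSet fun i => subst (PurePowerFlag.shift (b.2 - a.2)) (flagTuple d A a.1 a.2 i)) = δ₀ := by
      rw [dRes_shear_eq hE hH0, hδa]
    have hrC : excExp E (newtonSet fun i => subst (PurePowerFlag.shift (b.2 - a.2)) (flagTuple d A a.1 a.2 i)) = r₀ := by
      rw [excExp_shear_eq hE hH0, hra]
    have hsM : (M : ℕ∞) ≤ sFlag E (newtonSet (flagTuple d A a.1 a.2)) := by change (M : ℕ∞) ≤ s a; rw [hsa]
    have hsC := le_sFlag_shear_of_not_mem hE (flagTuple d A a.1 a.2) hH0 hsM (by rw [hδa]; exact hH)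
    refine ⟨hflag, hsC, hδC, hrC, ?_, ?_⟩
    · rw [← hflag, hδ b.1 b.2 hb.1 hb.2.1 hb.2.2, hδC]
    · rw [← hflag, hr b.1 b.2 hb.1 hb.2.1 hb.2.2, hrC]
  have hmono : ∀ {M M' : ℕ} {a b : Φ}, M ≤ M' → Close M' a b → Close M a b :=
    fun hMM' h => ⟨h.1, le_trans (by exact_mod_cast hMM') h.2.1, fun M'' hM'' => h.2.2 M'' (hM''.trans hMM')⟩
  have htrans : ∀ {M : ℕ} {a b c : Φ}, G a → G b → G c → Close M a b → Close M b c → Close M a c := by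
    intro M a b c ha hb hc hab hbc
    have hcb0 : PowerSeries.constantCoeff (c.2 - b.2) = 0 := by rw [map_sub, hb.2.1, hc.2.1, sub_zero]
    refine ⟨hbc.1, ?_, fun M' hM' => ?_⟩
    · have h1 : c.2 - a.2 = (c.2 - b.2) + (b.2 - a.2) := by ring
      rw [h1]
      refine le_trans ?_ (mul_le_mul_right (PowerSeries.min_order_le_order_add _ _) _)
      rw [mul_min]
      exact le_min hbc.2.1 hab.2.1
    · -- `relG a c = relG b c + θ_{c.2−b.2}^* (relG a b)`, and the shear does not lower the `M'`-line weight
      have hba0 : PowerSeries.constantCoeff (b.2 - a.2) = 0 := by rw [map_sub, ha.2.1, hb.2.1, sub_zero]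
      have hrel : relG a c = relG b c + subst (PurePowerFlag.shift (c.2 - b.2)) (relG a b) := by
        have hθ : HasSubst (PurePowerFlag.shift (c.2 - b.2)) := PurePowerFlag.hasSubst_shift' _ hcb0
        rw [relG_def, relG_def, relG_def, ← coe_substAlgHom hθ, map_sub, coe_substAlgHom hθ,
          PurePowerFlag.shift_eq, PurePowerFlag.shift_eq, PurePowerFlag.shift_eq,
          Literature.AlgebraicGeometry.Resolution.HauserPerlega2024.subst_shift_subst_shift (0 : Fin 2) 1 (by decide)
            (b.2 - a.2) (c.2 - b.2) hba0 hcb0 a.1,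
          show b.2 - a.2 + (c.2 - b.2) = c.2 - a.2 by ring]
        ring
      rw [hrel]
      have hM'H : (M' : ℕ∞) ≤ (δ₀.factorial : ℕ∞) * (c.2 - b.2).order := le_trans (by exact_mod_cast hM') hbc.2.1
      have h2 : ((M' * δ₀ + Finsupp.weight ![δ₀.factorial, M'] r₀ : ℕ) : ℕ∞) ≤
          (d.factorial : ℕ∞) * (subst (PurePowerFlag.shift (c.2 - b.2)) (relG a b)).weightedOrder ![δ₀.factorial, M'] :=
        le_trans (hab.2.2 M' hM') (mul_le_mul_right (le_weightedOrder_subst_shift _ _ hcb0 hM'H _) _)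
      have hmin : min ((relG b c).weightedOrder ![δ₀.factorial, M'])
          ((subst (PurePowerFlag.shift (c.2 - b.2)) (relG a b)).weightedOrder ![δ₀.factorial, M']) ≤
          (relG b c + subst (PurePowerFlag.shift (c.2 - b.2)) (relG a b)).weightedOrder ![δ₀.factorial, M'] :=
        min_weightedOrder_le_add _
      rcases min_choice ((relG b c).weightedOrder ![δ₀.factorial, M'])
          ((subst (PurePowerFlag.shift (c.2 - b.2)) (relG a b)).weightedOrder ![δ₀.factorial, M']) with h | h <;> rw [h] at hmin
      · exact (hbc.2.2 M' hM').trans (by gcongr)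
      · exact h2.trans (by gcongr)
  have hclean' : ∀ a : Φ, G a → (B₀ : ℕ∞) < s a → s a ≠ ⊤ → ∃ b, G b ∧ P b ∧ s a ≤ s b := by
    intro a ha hB hT
    obtain ⟨b, hb1, hb2, hb3, hbP, hle⟩ := hclean a ha.1 ha.2.1 ha.2.2 hB hT
    exact ⟨b, ⟨hb1, hb2, hb3⟩, hbP, hle⟩
  have hdrop : ∀ {a b : Φ} {M : ℕ}, G a → P a → G b → B₀ < M → s a = M → (M : ℕ∞) ≤ s b → Close M a b := by
    intro a b M ha hPa hb hB hsa hsb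
    have hH : (M : ℕ∞) ≤ (δ₀.factorial : ℕ∞) * (b.2 - a.2).order :=
      h3h a b M ha.1 ha.2.1 ha.2.2 hPa hb.1 hb.2.1 hb.2.2 hB hsa hsb
    refine ⟨hb, hH, fun M' hM' => ?_⟩
    obtain ⟨hflag, hsC, hδC, hrC, hδ', hr'⟩ := hshear ha hb hsa hH
    by_contra hlt
    rw [not_le] at hlt
    have hsM' : (M' : ℕ∞) ≤ sFlag E (newtonSet fun i => subst (PurePowerFlag.shift (b.2 - a.2)) (flagTuple d A a.1 a.2 i)) :=
      le_trans (by exact_mod_cast hM') hsC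
    have hlt' := sFlag_shift_lt E E _ (relG a b) hsM' hδ' hr' hd (by rw [hδC, hrC]; exact hlt)
    rw [← hflag] at hlt'
    have h2 : (M' : ℕ∞) ≤ s b := le_trans (by exact_mod_cast hM') hsb
    exact absurd (lt_of_le_of_lt h2 hlt') (lt_irrefl _)
  have husc : ∀ {a b : Φ} {M : ℕ}, G a → P a → G b → B₀ < M → s a = M → Close M a b → (M : ℕ∞) ≤ s b := by
    intro a b M ha _ hb _ hsa hab
    obtain ⟨hflag, hsC, hδC, hrC, hδ', hr'⟩ := hshear ha hb hsa hab.2.1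
    have h1 := natCast_le_sFlag_shift E E _ (relG a b) hsC hδ' hr' (by rw [hδC, hrC]; exact hab.2.2 M le_rfl)
    change (M : ℕ∞) ≤ sFlag E (newtonSet (flagTuple d A b.1 b.2))
    rw [hflag]
    exact h1
  have hcomplete : ∀ (c : ℕ → Φ) (N : ℕ → ℕ), StrictMono N → (∀ j, G (c j) ∧ P (c j) ∧ B₀ < N j ∧ s (c j) = N j) →
      (∀ j j', j < j' → Close (N j) (c j) (c j')) → ∃ b, G b ∧ ∀ j, Close (N j) (c j) b := by
    intro c N hN hc hch
    obtain ⟨ginf, hinf, hg0, hh0, hmem, hclose⟩ := exists_limit_mem_pairClass hd A W m δ₀ r₀ hW hpos hmax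
      (fun j => (c j).1) (fun j => (c j).2) N hN (fun j => ⟨(hc j).1.1, (hc j).1.2.1, (hc j).1.2.2⟩)
      (fun j => (hch j (j + 1) (Nat.lt_succ_self j)).2.1)
      (fun j j' hjj' M' hM' => by
        have h := (hch j j' hjj').2.2 M' hM'
        rwa [relG_def] at h)
    refine ⟨(ginf, hinf), ⟨hg0, hh0, hmem⟩, fun j => ⟨⟨hg0, hh0, hmem⟩, (hclose j).1, fun M' hM' => ?_⟩⟩
    rw [relG_def]
    exact (hclose j).2 M' hM'
  obtain ⟨g₀, h₀, hg₀, hh₀, hm₀⟩ := hne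
  obtain ⟨a, ha, has, hmax'⟩ := exists_isGreatest_of_complete₂ s G P Close B₀ hmono htrans hclean' hdrop husc hcomplete
    ⟨(g₀, h₀), hg₀, hh₀, hm₀⟩ (fun a ha => hfin a.1 a.2 ha.1 ha.2.1 ha.2.2)
  exact ⟨a.1, a.2, ha.1, ha.2.1, ha.2.2, has, fun g' h' hg' hh' hm' => hmax' (g', h') ⟨hg', hh', hm'⟩⟩

end WildMonic

end Summit.ResolutionOfSingularities.ResolutionOfSingularities.Theorems

end
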